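import Mathlib
import HarnessLib

/-!
# Route `BECTangentRigidity`, crux `RigidMomentumBound` (stmt-AtomisticToContinuum-13034):
# stub `stub_slopeChain` — chaining one-sided local increment bounds along an interval

A pure real-variable lemma ("real induction" on `[a, b]`).  Let `g : ℝ → ℝ`, `a ≤ b`, `0 ≤ B`, and
assume

* (no downward jump to the right) at every `t ∈ [a, b)`: for every `η > 0` there is `w₀ > 0` with
  `g t ≤ g (t + w) + η` whenever `0 < w < w₀` and `t + w ≤ b`;
* (left increments) at every `t ∈ (a, b]`: there is `w₀ > 0` with `g (t - w) ≤ g t + B w`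
  whenever `0 < w ≤ w₀` and `a ≤ t - w`.

Then `g a ≤ g b + B (b - a)`.

Proof.  Let `S := {t ∈ [a, b] | g t ≤ g b + B (b - t)}`; then `b ∈ S`, `S` is bounded below by
`a`, and `t⋆ := sInf S ∈ [a, b]`.
1. `t⋆ ∈ S`: otherwise `t⋆ < b`, and for every `η > 0` the first hypothesis at `t⋆` gives `w₀`;
   some `s ∈ S` has `t⋆ ≤ s < t⋆ + w₀` and `s ≠ t⋆`, so with `w := s - t⋆` we get
   `g t⋆ ≤ g s + η ≤ g b + B (b - s) + η ≤ g b + B (b - t⋆) + η` (`B ≥ 0`, `s ≥ t⋆`); letting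
   `η → 0` puts `t⋆ ∈ S`, a contradiction.
2. `t⋆ = a`: otherwise the second hypothesis at `t⋆ ∈ (a, b]` gives `w₀`, and
   `w := min w₀ (t⋆ - a) > 0` has `t⋆ - w ∈ S`, contradicting `t⋆ = sInf S ≤ t⋆ - w < t⋆`.

No monotonicity or continuity of `g` is assumed.  In the line `registered` this is applied with
`g t = (E₀(N, t)).toReal`, the Dirichlet ground-state energy of the box of side `t`: the first
hypothesis is right-continuity of the box energy, the second is Hadamard's wall-flux bound.
Only Mathlib's conditionally complete lattice API on `ℝ` (`csInf_le`, `le_csInf`,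
`exists_lt_of_csInf_lt`) and `le_of_forall_pos_le_add` are used.
-/

namespace Summit.AtomisticToContinuum.BoseEinsteinCondensation.Theorems.RigidMomentumBound

open Set

/-- **`stub_slopeChain`** (real analysis).  Let `g : ℝ → ℝ`, `a ≤ b`, `B ≥ 0`.  If at every
`t ∈ [a, b)` the function does not jump down to the right (`∀ η > 0`, `g t ≤ g (t + w) + η` for all
small `w > 0` with `t + w ≤ b`) and at every `t ∈ (a, b]` it has left increments
`g (t - w) ≤ g t + B w` for all small `w > 0` with `a ≤ t - w`, then `g a ≤ g b + B (b - a)`.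
Proof: the set `S = {t ∈ [a, b] : g t ≤ g b + B (b - t)}` contains `b`; its infimum `t⋆` belongs
to `S` by the first hypothesis (approach `t⋆` by points of `S` from the right), and `t⋆ > a` would
put `t⋆ - w ∈ S` for a small `w > 0` by the second. [folklore] -/
theorem stub_slopeChain :
    ∀ (g : ℝ → ℝ) (a b B : ℝ), a ≤ b → 0 ≤ B →
      (∀ t ∈ Set.Ico a b, ∀ η : ℝ, 0 < η → ∃ w₀ : ℝ, 0 < w₀ ∧
          ∀ w : ℝ, 0 < w → w < w₀ → t + w ≤ b → g t ≤ g (t + w) + η) →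
      (∀ t ∈ Set.Ioc a b, ∃ w₀ : ℝ, 0 < w₀ ∧
          ∀ w : ℝ, 0 < w → w ≤ w₀ → a ≤ t - w → g (t - w) ≤ g t + B * w) →
      g a ≤ g b + B * (b - a) := by
  intro g a b B hab hB hright hleft
  -- the chaining set and its infimum
  set S : Set ℝ := {t | t ∈ Icc a b ∧ g t ≤ g b + B * (b - t)}
  have hbS : b ∈ S := ⟨⟨hab, le_rfl⟩, by simp⟩
  have hSne : S.Nonempty := ⟨b, hbS⟩
  have hSbdd : BddBelow S := ⟨a, fun t ht => ht.1.1⟩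
  have hac : a ≤ sInf S := le_csInf hSne fun t ht => ht.1.1
  have hcb : sInf S ≤ b := csInf_le hSbdd hbS
  -- Step 1: the infimum belongs to `S` (right no-jump hypothesis)
  have hmem : sInf S ∈ S := by
    by_contra hnot
    have hcb' : sInf S < b := lt_of_le_of_ne hcb fun h => hnot (by rw [h]; exact hbS)
    refine hnot ⟨⟨hac, hcb⟩, le_of_forall_pos_le_add fun η hη => ?_⟩
    obtain ⟨w₀, hw₀, hw⟩ := hright (sInf S) ⟨hac, hcb'⟩ η hη
    obtain ⟨s, hsS, hslt⟩ :=
      exists_lt_of_csInf_lt hSne (show sInf S < sInf S + w₀ from lt_add_of_pos_right _ hw₀)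
    have hcs : sInf S ≤ s := csInf_le hSbdd hsS
    have hcs' : sInf S < s := lt_of_le_of_ne hcs fun h => hnot (by rw [h]; exact hsS)
    have hsb : s ≤ b := hsS.1.2
    have h1 : g (sInf S) ≤ g (sInf S + (s - sInf S)) + η :=
      hw (s - sInf S) (sub_pos.mpr hcs') (by linarith) (by linarith)
    have h2 : sInf S + (s - sInf S) = s := by ring
    rw [h2] at h1
    have h3 : g s ≤ g b + B * (b - s) := hsS.2
    have h4 : B * (b - s) ≤ B * (b - sInf S) := mul_le_mul_of_nonneg_left (by linarith) hB
    linarith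
  -- Step 2: the infimum is `a` (left-increment hypothesis)
  have heq : sInf S = a := by
    by_contra hne
    have hac' : a < sInf S := lt_of_le_of_ne hac (Ne.symm hne)
    obtain ⟨w₀, hw₀, hw⟩ := hleft (sInf S) ⟨hac', hcb⟩
    have hwpos : 0 < min w₀ (sInf S - a) := lt_min hw₀ (sub_pos.mpr hac')
    have hww₀ : min w₀ (sInf S - a) ≤ w₀ := min_le_left _ _
    have hwca : min w₀ (sInf S - a) ≤ sInf S - a := min_le_right _ _
    have h1 : g (sInf S - min w₀ (sInf S - a)) ≤ g (sInf S) + B * min w₀ (sInf S - a) :=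
      hw _ hwpos hww₀ (by linarith)
    have h2 : g (sInf S) ≤ g b + B * (b - sInf S) := hmem.2
    have hmemw : sInf S - min w₀ (sInf S - a) ∈ S := by
      refine ⟨⟨by linarith, by linarith⟩, ?_⟩
      have h3 : B * (b - sInf S) + B * min w₀ (sInf S - a) =
          B * (b - (sInf S - min w₀ (sInf S - a))) := by ring
      linarith
    have h4 : sInf S ≤ sInf S - min w₀ (sInf S - a) := csInf_le hSbdd hmemw
    linarith
  -- conclusion: `a = sInf S ∈ S`
  have hfin : g (sInf S) ≤ g b + B * (b - sInf S) := hmem.2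
  rw [heq] at hfin
  exact hfin

end Summit.AtomisticToContinuum.BoseEinsteinCondensation.Theorems.RigidMomentumBound
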